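import Mathlib
import HarnessLib
import Summits.NavierStokesRegularity.NavierStokesRegularity.Theorems.HalfSpaceWindowDoorCirculationCarryingRigidityRotHead
import Summits.NavierStokesRegularity.NavierStokesRegularity.Theorems.HalfSpaceWindowDoorCirculationCarryingRigiditySkewDrift

/-!
# Route `HalfSpaceWindowDoor`, crux `CirculationCarryingRigidity` (stmt-NavierStokesRegularity-25311) — line
# `rot_bernoulli`, III: the LIOUVILLE THEOREM for rotated Leray profiles with counter-signed vertical vorticity

LEAD ns-hsw-p1 g11 (cell pub-ns-dss).  Assembly of `…RotHead` (the exact identity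
`ν ΔΠ_α − (U + a y − αJy)·∇Π_α = (ν/2)|DU − DUᵀ|² + 2να tr(J∘DU)` for the rotation-corrected Bernoulli function
`Π_α = P + ½|U|² + a y·U − α (Jy)·U` of a rotated Leray profile) with `…SkewDrift` (Tsai's Lemma 5.1 for drifts with a skew
linear part):

* `exists_eq_const_of_rotProfile` (any finite-dimensional inner product space `E`, any skew `J`, `ν > 0`, `a > 0`): a
  rotated Leray profile `−νΔU + aU + a(y·∇)U + (U·∇)U + ∇P + α(JU − (Jy·∇)U) = 0`, `div U = 0`, with `U ∈ C³` BOUNDED,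
  `P ∈ C²` polynomially bounded and `α·tr(J∘DU) ≥ 0` everywhere, is CONSTANT (`Π_α` is a polynomially bounded
  subsolution ⇒ constant ⇒ `ΔU ≡ 0` ⇒ bounded harmonic ⇒ constant);
* `exists_eq_const_of_rotProfile_signE3` (`ℝ³`, `J = e₃×`): the same for profiles with ONE-SIGNED VERTICAL VORTICITY
  `(curl U)₂ ≥ 0` (the closed-hemisphere condition of the door) and `α ≤ 0` — every angular speed, no smallness;
* `eq_zero_of_rotProfile_signE3` — if moreover `U` decays (`‖U(y)‖ ≤ C₀/(1 + ‖y‖)`, the Type-I profile bound (1.9) of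
  Pineau–Vicol) then `U ≡ 0`.

READING (Pineau–Vicol arXiv:2607.09619, Conjecture 1.1 = Tsai GSM 192 Conj. 8.9 = Bradshaw–Tsai OP 5.2: «for `α ≠ 0` a
smooth RSS profile with `|U(y)| ≤ C/(1+|y|)` vanishes»; known for `|α| ≪ 1` and `|α| ≫ 1`, their Thm 1.4): in the class of
profiles whose vertical vorticity has a sign OPPOSITE to the rotation (`αω₃ ≤ 0` pointwise) the conjecture holds for EVERY
`α`, by a maximum principle — the mechanism Pineau–Vicol (p. 4) describe as unavailable for `α ≠ 0` in general.  For the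
door (census of W6 = `HemisphereLiouvilleE3`): the ROTATED-SELF-SIMILAR COUNTER-ROTATING stratum of the closed-hemisphere
class is empty (`…RotHeadCensus`); `α = 0` is Tsai's theorem (tree `eq_zero_of_selfSimilar`); the co-rotating stratum
`α > 0` (defect `|Ω|² − 2αΩ₃` indefinite) stays open.

WHAT THIS IS NOT: not a statement about Navier–Stokes regularity (Clay A); the door statements concern HYPOTHETICAL blow-up
profiles; helper `--supports` 25311; the item stays OPEN at its research stub.
-/

noncomputable section

-- the summit and its single sub-problem share the name (CONVENTIONS §1), as in every Theorems file
set_option linter.dupNamespace false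

namespace Summit.NavierStokesRegularity.NavierStokesRegularity.Theorems.HalfSpaceWindowDoorCirculationCarryingRigidityRotHeadLiouville

open Set Function Filter Topology InnerProductSpace Metric
open scoped RealInnerProductSpace Laplacian ContDiff
open Literature.Analysis Literature.Analysis.FluidPDE
open Summit.NavierStokesRegularity.NavierStokesRegularity.Theorems.HalfSpaceWindowDoorCirculationCarryingRigidityRotHead
open Summit.NavierStokesRegularity.NavierStokesRegularity.Theorems.HalfSpaceWindowDoorCirculationCarryingRigiditySkewDrift

variable {E : Type*} [NormedAddCommGroup E] [InnerProductSpace ℝ E] [FiniteDimensional ℝ E]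

/-! ### Polynomial growth of the rotation-corrected head pressure -/

omit [FiniteDimensional ℝ E] in
/-- `|Π_α(y)| ≤ K (1 + |y|)^{N+2}` for a bounded profile and a polynomially bounded pressure (the correction term is
`|α ⟪Jy, U⟫| ≤ |α| ‖J‖ M |y|`). -/
theorem abs_rotHead_le {a α M C : ℝ} {N : ℕ} (J : E →L[ℝ] E) {U : E → E} {P : E → ℝ} (ha : 0 ≤ a)
    (hM : 0 ≤ M) (hC : 0 ≤ C) (hU : ∀ y, ‖U y‖ ≤ M) (hP : ∀ y, |P y| ≤ C * (1 + ‖y‖) ^ N) (y : E) :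
    |headPressure a U P y - α * ⟪J y, U y⟫| ≤
      (2⁻¹ * M ^ 2 + C + a * M + |α| * ‖J‖ * M) * (1 + ‖y‖) ^ (N + 2) := by
  have hU' : ∀ y, ‖U y‖ ≤ M + 0 * ‖y‖ := fun y => by simpa using hU y
  have h1 := abs_headPressure_le (N := N) ha le_rfl hM hC hU' hP y
  simp only [add_zero] at h1
  set t := 1 + ‖y‖ with ht
  have ht1 : 1 ≤ t := by rw [ht]; linarith [norm_nonneg y]
  have hyt : ‖y‖ ≤ t ^ (N + 2) := by
    calc ‖y‖ ≤ t := by rw [ht]; linarith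
      _ = t ^ 1 := (pow_one t).symm
      _ ≤ t ^ (N + 2) := pow_le_pow_right₀ ht1 (by omega)
  have h2 : |α * ⟪J y, U y⟫| ≤ |α| * ‖J‖ * M * t ^ (N + 2) := by
    rw [abs_mul]
    have hin : |⟪J y, U y⟫| ≤ ‖J y‖ * ‖U y‖ := abs_real_inner_le_norm _ _
    have hJy : ‖J y‖ ≤ ‖J‖ * ‖y‖ := J.le_opNorm y
    have hJ0 : 0 ≤ ‖J‖ := norm_nonneg _
    calc |α| * |⟪J y, U y⟫| ≤ |α| * (‖J‖ * ‖y‖ * M) := by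
          gcongr
          calc |⟪J y, U y⟫| ≤ ‖J y‖ * ‖U y‖ := hin
            _ ≤ (‖J‖ * ‖y‖) * M := by gcongr; exact hU y
      _ ≤ |α| * (‖J‖ * t ^ (N + 2) * M) := by gcongr
      _ = |α| * ‖J‖ * M * t ^ (N + 2) := by ring
  calc |headPressure a U P y - α * ⟪J y, U y⟫|
      ≤ |headPressure a U P y| + |α * ⟪J y, U y⟫| := abs_sub _ _
    _ ≤ (2⁻¹ * M ^ 2 + C + a * M) * t ^ (N + 2) + |α| * ‖J‖ * M * t ^ (N + 2) := add_le_add h1 h2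
    _ = _ := by ring

/-! ### The Liouville theorem -/

/-- **Bounded rotated Leray profiles with `α·tr(J∘DU) ≥ 0` are constant.**  Let `ν > 0`, `a > 0`, `J` skew, and let
`(U, P)` (`U ∈ C³` bounded, `P ∈ C²` polynomially bounded) solve the rotated profile system
`−νΔU + aU + a(y·∇)U + (U·∇)U + ∇P + α(JU − (Jy·∇)U) = 0`, `div U = 0`, with `α·tr(J ∘ DU(y)) ≥ 0` for all `y`
(on `ℝ³`, `J = e₃×`: `α ω₃ ≤ 0`).  Then `U` is constant.  (Rotation-corrected Bernoulli function `Π_α`: a `C²`,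
polynomially bounded subsolution of `νΔ − (U + a y − αJy)·∇` (`…RotHead.driftOp_rotHead_nonneg`) ⇒ constant by Tsai's
Lemma 5.1 with skew drift (`…SkewDrift.isConst_of_driftOp_nonneg_of_poly_skew`) ⇒ `ΔU ≡ 0`
(`…RotHead.spin_eq_zero_and_laplacian_eq_zero_of_rotHead_const`) ⇒ constant (bounded harmonic).) -/
theorem exists_eq_const_of_rotProfile [MeasurableSpace E] [BorelSpace E] {ν a α : ℝ} (hν : 0 < ν) (ha : 0 < a)
    {J : E →L[ℝ] E} (hJ : ∀ v w, ⟪J v, w⟫ = -⟪v, J w⟫) {U : E → E} {P : E → ℝ}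
    (hU3 : ContDiff ℝ 3 U) (hP2 : ContDiff ℝ 2 P) (hdiv : VectorCalculus.IsDivFree U)
    (heq : ∀ y, -(ν • (Δ U) y) + a • U y + a • fderiv ℝ U y y + convect U U y + gradient P y +
      α • (J (U y) - fderiv ℝ U y (J y)) = 0)
    (hUbdd : ∃ M : ℝ, ∀ y, ‖U y‖ ≤ M) (hPpoly : ∃ C : ℝ, ∃ N : ℕ, ∀ y, |P y| ≤ C * (1 + ‖y‖) ^ N)
    (hsign : ∀ y, 0 ≤ α * traceCLM (J.comp (fderiv ℝ U y))) :
    ∃ c : E, ∀ y, U y = c := by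
  obtain ⟨M, hM⟩ := hUbdd
  obtain ⟨C, N, hPC⟩ := hPpoly
  set M₀ := max M 0 with hM₀
  have hM₀0 : 0 ≤ M₀ := le_max_right _ _
  have hUM₀ : ∀ y, ‖U y‖ ≤ M₀ := fun y => (hM y).trans (le_max_left _ _)
  set C₀ := max C 0 with hC₀
  have hC₀0 : 0 ≤ C₀ := le_max_right _ _
  have hPC₀ : ∀ y, |P y| ≤ C₀ * (1 + ‖y‖) ^ N := fun y =>
    (hPC y).trans (mul_le_mul_of_nonneg_right (le_max_left _ _) (by positivity))
  have hU2 : ContDiff ℝ 2 U := hU3.of_le (by norm_num)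
  have hΘ : ContDiff ℝ 2 fun y => headPressure a U P y - α * ⟪J y, U y⟫ := contDiff_rotHead J hU2 hP2
  -- the drift `U − αJ + a y = (U + T) + a y` with the skew map `T = (−α) J`
  set T : E →L[ℝ] E := (-α) • J with hT
  have hTskew : ∀ v, ⟪v, T v⟫ = 0 := fun v => by
    have h := hJ v v
    rw [real_inner_comm (J v) v] at h
    have h0 : ⟪v, J v⟫ = 0 := by
      rw [real_inner_comm]
      linarith
    rw [hT, _root_.smul_apply, real_inner_smul_right, h0, mul_zero]
  have hfun : (fun z => U z + T z) = fun z => U z - α • J z := by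
    funext z
    rw [hT, _root_.smul_apply, neg_smul, ← sub_eq_add_neg]
  have hsub : ∀ y, 0 ≤ driftOp ν a (fun z => U z + T z) (fun y => headPressure a U P y - α * ⟪J y, U y⟫) y :=
    fun y => by
      rw [hfun]
      exact driftOp_rotHead_nonneg hJ hU3 hP2 hdiv heq hν.le (hsign y)
  -- growth `|U(y)| ≤ (a/2)|y|` for `|y| ≥ 2M₀/a`
  have hUb : ∀ y : E, 2 * M₀ / a ≤ ‖y‖ → ‖U y‖ ≤ a / 2 * ‖y‖ := by
    intro y hy
    have : M₀ ≤ a / 2 * ‖y‖ := by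
      rw [div_le_iff₀ ha] at hy
      linarith
    exact (hUM₀ y).trans this
  have hgrowth := abs_rotHead_le (α := α) (N := N) J ha.le hM₀0 hC₀0 hUM₀ hPC₀
  have hconst := isConst_of_driftOp_nonneg_of_poly_skew hν (b := a / 2) (by positivity) (half_lt_self ha) hΘ
    hU2.continuous hsub hUb hTskew hgrowth
  have hΔ : ∀ y, (Δ U) y = 0 := fun y =>
    (spin_eq_zero_and_laplacian_eq_zero_of_rotHead_const hJ hU3 hP2 hdiv heq hν hsign hconst y).2
  exact ⟨U 0, fun y => isConst_of_harmonic_bounded_inner (harmonicOnNhd_of_laplacian_eq_zero hU2 hΔ)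
    ⟨M₀, hUM₀⟩ y 0⟩

/-! ### `ℝ³`, vertical axis: the closed-hemisphere counter-rotating Liouville theorem -/

/-- **Rotated Leray profiles with one-signed vertical vorticity and counter-rotation are constant.**  On `ℝ³` with
`J = e₃×` (`rotGenL`): a bounded `C³` profile of the rotated Leray system with `C²` polynomially bounded pressure,
`(curl U)₂ ≥ 0` everywhere and angular speed `α ≤ 0` is constant (`ν > 0`, `a > 0`; no smallness of `|α|`). -/
theorem exists_eq_const_of_rotProfile_signE3 {ν a α : ℝ} (hν : 0 < ν) (ha : 0 < a)
    {U : EuclideanSpace ℝ (Fin 3) → EuclideanSpace ℝ (Fin 3)} {P : EuclideanSpace ℝ (Fin 3) → ℝ}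
    (hU3 : ContDiff ℝ 3 U) (hP2 : ContDiff ℝ 2 P) (hdiv : VectorCalculus.IsDivFree U)
    (heq : ∀ y, -(ν • (Δ U) y) + a • U y + a • fderiv ℝ U y y + convect U U y + gradient P y +
      α • (rotGenL (U y) - fderiv ℝ U y (rotGenL y)) = 0)
    (hUbdd : ∃ M : ℝ, ∀ y, ‖U y‖ ≤ M) (hPpoly : ∃ C : ℝ, ∃ N : ℕ, ∀ y, |P y| ≤ C * (1 + ‖y‖) ^ N)
    (hα : α ≤ 0) (hsign : ∀ y, 0 ≤ curl U y 2) :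
    ∃ c : EuclideanSpace ℝ (Fin 3), ∀ y, U y = c := by
  refine exists_eq_const_of_rotProfile hν ha rotGenL_skew hU3 hP2 hdiv heq hUbdd hPpoly fun y => ?_
  rw [traceCLM_rotGenL_comp_fderiv, mul_neg]
  exact neg_nonneg.2 (mul_nonpos_of_nonpos_of_nonneg hα (hsign y))

/-- **… and vanish if they decay.**  Under the Type-I profile bound `‖U(y)‖ ≤ C₀/(1 + ‖y‖)` (Pineau–Vicol (1.9)) the
constant is `0`: `U ≡ 0`.  (Pineau–Vicol's Conjecture 1.1 in the counter-rotating closed-hemisphere class, all `α ≤ 0`.) -/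
theorem eq_zero_of_rotProfile_signE3 {ν a α C₀ : ℝ} (hν : 0 < ν) (ha : 0 < a)
    {U : EuclideanSpace ℝ (Fin 3) → EuclideanSpace ℝ (Fin 3)} {P : EuclideanSpace ℝ (Fin 3) → ℝ}
    (hU3 : ContDiff ℝ 3 U) (hP2 : ContDiff ℝ 2 P) (hdiv : VectorCalculus.IsDivFree U)
    (heq : ∀ y, -(ν • (Δ U) y) + a • U y + a • fderiv ℝ U y y + convect U U y + gradient P y +
      α • (rotGenL (U y) - fderiv ℝ U y (rotGenL y)) = 0)
    (hdec : ∀ y, ‖U y‖ ≤ C₀ / (1 + ‖y‖)) (hPpoly : ∃ C : ℝ, ∃ N : ℕ, ∀ y, |P y| ≤ C * (1 + ‖y‖) ^ N)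
    (hα : α ≤ 0) (hsign : ∀ y, 0 ≤ curl U y 2) : ∀ y, U y = 0 := by
  have hUbdd : ∃ M : ℝ, ∀ y, ‖U y‖ ≤ M := ⟨C₀, fun y => (hdec y).trans (by
    have h1 : (1 : ℝ) ≤ 1 + ‖y‖ := by linarith [norm_nonneg y]
    have hC₀ : 0 ≤ C₀ := le_trans (by positivity) ((le_div_iff₀ (by linarith)).1 (le_trans (norm_nonneg _) (hdec y)))
    exact div_le_self hC₀ h1)⟩
  obtain ⟨c, hc⟩ := exists_eq_const_of_rotProfile_signE3 hν ha hU3 hP2 hdiv heq hUbdd hPpoly hα hsign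
  -- the constant decays, hence vanishes
  have hc0 : c = 0 := by
    by_contra hne
    have hcpos : 0 < ‖c‖ := norm_pos_iff.2 hne
    -- test at `y = t • c` with `t` large
    have hC₀ : 0 ≤ C₀ := by
      have := (norm_nonneg _).trans (hdec 0)
      simpa using this
    set t : ℝ := (C₀ / ‖c‖ + 1) / ‖c‖ with ht
    have ht0 : 0 ≤ t := div_nonneg (add_nonneg (div_nonneg hC₀ hcpos.le) zero_le_one) hcpos.le
    have hy : ‖t • c‖ = C₀ / ‖c‖ + 1 := by
      rw [norm_smul, Real.norm_eq_abs, abs_of_nonneg ht0, ht]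
      field_simp
    have h := hdec (t • c)
    rw [hc, hy] at h
    have h2 : ‖c‖ * (1 + (C₀ / ‖c‖ + 1)) ≤ C₀ := by
      rwa [le_div_iff₀ (by positivity)] at h
    have h3 : ‖c‖ * (1 + (C₀ / ‖c‖ + 1)) = C₀ + 2 * ‖c‖ := by
      field_simp
      ring
    linarith
  intro y
  rw [hc, hc0]

end Summit.NavierStokesRegularity.NavierStokesRegularity.Theorems.HalfSpaceWindowDoorCirculationCarryingRigidityRotHeadLiouville

end
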